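import Literature.AlgebraicGeometry.Resolution.HilbertSamuelStrata
import Mathlib.AlgebraicGeometry.Morphisms.Proper
import Mathlib.AlgebraicGeometry.Morphisms.FiniteType
import Mathlib.Order.OrderIsoNat

/-!
# `ModificationsResolve` (crux stmt-ResolutionOfSingularities-18507), line `Sketch`:
# `stub_wellFounded_hsStep` is FALSE without its conjunct `Nonempty Y`
# (negative-side support for the lead's skeleton sha 299ec40d…; refuter cdisprove seat)

The lead's stub asserts well-foundedness of the one-step relation
`R Y' Y := (Y of finite type over k) ∧ Nonempty Y ∧ dim Y < N ∧ ∃ π : Y' → Y proper, H non-increasing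
along π, (ME2)` — CJS Thm. 6.17 in the tree's termination form
(`Scheme.no_infinite_hsFun_tower_of_isExcellent`). We record, sorry-free, that the conjunct
`Nonempty Y` cannot be dropped: `not_wellFounded_hsStep_without_nonempty` — the constant sequence
`∅, ∅, …` with identity maps is an infinite descending chain of the relation without it
(`∅ → Spec k` is locally of finite type and quasi-compact, `dim ∅ = ⊥ < N`, `𝟙 ∅` is proper, and
monotonicity / (ME2) quantify over no points / no values). In the tower of crux 3 the conjunct is
supplied by "a non-regular scheme is non-empty". This file refutes nothing in `Theses/`.
-/

noncomputable section

set_option linter.dupNamespace false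

namespace Summit.ResolutionOfSingularities.ResolutionOfSingularities.Theorems.ModificationsResolve.Negative

open CategoryTheory AlgebraicGeometry TopologicalSpace
open Literature.AlgebraicGeometry.Resolution

/-- **`stub_wellFounded_hsStep` minus `Nonempty Y` is false** (the empty tower). -/
theorem not_wellFounded_hsStep_without_nonempty (k : Type) [Field k] (N : ℕ) :
    ¬ WellFounded (fun Y' Y : Scheme.{0} =>
      (∃ g : Y ⟶ Spec (.of k), LocallyOfFiniteType g ∧ QuasiCompact g) ∧
        topologicalKrullDim Y < (N : WithBot ℕ∞) ∧
        ∃ π : Y' ⟶ Y, IsProper π ∧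
          (∀ x' : Y', Scheme.hsFun Y' N x' ≤ Scheme.hsFun Y N (π.base x')) ∧
          ∀ ν : ℕ → ℕ, Maximal (· ∈ Scheme.hsValues Y N) ν → ν ∉ Scheme.hsValues Y' N) := by
  intro h
  have hdim : topologicalKrullDim (∅ : Scheme.{0}) = ⊥ := by
    unfold topologicalKrullDim
    haveI : IsEmpty (IrreducibleCloseds (∅ : Scheme.{0})) :=
      ⟨fun Z => isEmptyElim Z.2.nonempty.some⟩
    exact Order.krullDim_eq_bot
  refine (wellFounded_iff_isEmpty_descending_chain.mp h).false ⟨fun _ => ∅, fun n => ?_⟩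
  refine ⟨⟨Scheme.emptyTo _, inferInstance, inferInstance⟩, ?_, 𝟙 _, inferInstance, ?_, ?_⟩
  · rw [hdim]; exact WithBot.bot_lt_coe _
  · intro x; exact isEmptyElim x
  · rintro ν ⟨⟨x, -⟩, -⟩; exact isEmptyElim x

end Summit.ResolutionOfSingularities.ResolutionOfSingularities.Theorems.ModificationsResolve.Negative

end
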